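import Mathlib
import Literature.Computability.AlgebraicComplexity.RazElusiveGeneralRouteProofs
import Literature.Computability.AlgebraicComplexity.StandardFamilies
import HarnessLib

/-!
# ValiantsHypothesis / TwoAdicLadder — crux `PrecisionLadder` (stmt-ValiantsHypothesis-5948),
# line `Cruxes/PrecisionLadder/Lines/birth.lean`, registered stub `stub_localise`

The registered stub `stub_localise` (size M, "provable now") is PROVED here, verbatim as registered:
a FINITE commutative principal ideal ring `R` in which `2` is nilpotent and `2^k ≠ 0` maps (ring
homomorphism) to a finite LOCAL principal ideal ring `S` of characteristic EXACTLY `2^(k+1)`, and along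
that map the circuit complexity of the permanent can only drop:
`complexity (per_n over S) ≤ complexity (per_n over R)`.

## Proof (Mathlib by name)

* `R` is finite, hence Artinian (`isArtinian_of_finite`); since `2^k ≠ 0` in `R`, some maximal ideal
  `𝔪` has `2^k ≠ 0` in the localisation `R_𝔪` (`eq_zero_of_localization`).
* `S₀ := Localization.AtPrime 𝔪` is local, and a QUOTIENT of `R` (`IsArtinianRing.localization_surjective`),
  hence a finite principal ideal ring (`IsPrincipalIdealRing.of_surjective`, `Finite.of_surjective`).
* `S := S₀ ⧸ (2^(k+1))`: local (`IsLocalRing.of_surjective'`), principal, finite; and `2^k ≠ 0` in `S`,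
  for `2^k = r · 2^(k+1)` in `S₀` gives `2^k (1 − 2r) = 0` with `1 − 2r` a unit (`2r` is nilpotent,
  `IsNilpotent.isUnit_one_sub`), i.e. `2^k = 0` in `S₀` — so the characteristic of `S`, a divisor of
  `2^(k+1)` (`Nat.dvd_prime_pow`), is exactly `2^(k+1)`.
* `complexity` does not increase along `R →+* S` (tree `ArithCircuit.complexity_map_le`, `map_perPoly`).

Honest framing: this is the localisation BOOKKEEPING stub of the line; `stub_ladderZ` (explicit
super-polynomial lower bounds for the permanent over the prime rings `ℤ/2^(k+1)`) and `stub_descent`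
remain OPEN, as does the crux `TwoAdicLadder.PrecisionLadder`; `VP ≠ VNP` is NOT proved and nothing here
is progress on it. No new definitions, no named facts.
-/

-- `Summit.ValiantsHypothesis.ValiantsHypothesis.…` is the tree's mandated single-conjunct layout
-- (Sub = Summit), so the duplicated namespace component is intended.
set_option linter.dupNamespace false

namespace Summit.ValiantsHypothesis.ValiantsHypothesis.Theorems.TwoAdicLadderPrecisionLadder

open Literature.Computability.AlgebraicComplexity

/-- In a commutative ring in which `2` is nilpotent, `2 ^ k ∈ (2 ^ (k + 1))` forces `2 ^ k = 0`
(`2^k = r·2^(k+1)` gives `2^k · (1 − 2r) = 0` with `1 − 2r` a unit). [folklore] -/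
theorem two_pow_eq_zero_of_mem_span {A : Type*} [CommRing A] (h2 : IsNilpotent (2 : A)) {k : ℕ}
    (hmem : (2 : A) ^ k ∈ Ideal.span {(2 : A) ^ (k + 1)}) : (2 : A) ^ k = 0 := by
  obtain ⟨r, hr⟩ := Ideal.mem_span_singleton'.1 hmem
  have hnil : IsNilpotent (r * 2) := Commute.isNilpotent_mul_left (Commute.all _ _) h2
  have hu : IsUnit (1 - r * 2) := hnil.isUnit_one_sub
  have hzero : (1 - r * 2) * (2 : A) ^ k = 0 := by
    have : r * 2 * (2 : A) ^ k = (2 : A) ^ k := by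
      rw [mul_assoc, ← pow_succ', hr]
    rw [sub_mul, one_mul, this, sub_self]
  exact (hu.mul_right_eq_zero).1 hzero

/-- If `(2 : A) ^ (k+1) = 0` and `(2 : A) ^ k ≠ 0` then `A` has characteristic exactly `2 ^ (k + 1)`.
[folklore] -/
theorem charP_two_pow_succ {A : Type*} [CommRing A] {k : ℕ} (h0 : (2 : A) ^ (k + 1) = 0)
    (hk : (2 : A) ^ k ≠ 0) : CharP A (2 ^ (k + 1)) := by
  obtain ⟨p, hp⟩ := CharP.exists A
  have hdvd : p ∣ 2 ^ (k + 1) := by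
    rw [← CharP.cast_eq_zero_iff A p (2 ^ (k + 1))]
    exact_mod_cast h0
  obtain ⟨j, hj, rfl⟩ := (Nat.dvd_prime_pow Nat.prime_two).1 hdvd
  rcases Nat.lt_or_ge j (k + 1) with hlt | hge
  · exfalso
    apply hk
    have hcast : ((2 ^ j : ℕ) : A) = 0 := CharP.cast_eq_zero A (2 ^ j)
    have h2j : (2 : A) ^ j = 0 := by exact_mod_cast hcast
    have hkj : k = j + (k - j) := by omega
    rw [hkj, pow_add, h2j, zero_mul]
  · have : j = k + 1 := le_antisymm hj hge
    subst this
    exact hp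

/-- **stub_localise** (registered stub of crux `TwoAdicLadder.PrecisionLadder`, stmt-ValiantsHypothesis-5948,
line `birth`; signature VERBATIM as registered).  Localisation of a finite principal ideal ring with `2`
nilpotent and `2^k ≠ 0` to a finite LOCAL principal ideal ring of characteristic exactly `2^(k+1)`, along
which the circuit complexity of the permanent does not increase (Artinian structure theory +
extension of scalars is free). [folklore] -/
theorem stub_localise :
    ∀ (n k : ℕ) (R : Type) [CommRing R] [Fintype R],
      IsPrincipalIdealRing R → IsNilpotent (2 : R) → (2 : R) ^ k ≠ 0 →
      ∃ (S : Type) (_ : CommRing S) (_ : Fintype S),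
        IsLocalRing S ∧ IsPrincipalIdealRing S ∧ CharP S (2 ^ (k + 1)) ∧
        complexity (perPoly (Fin n) S) ≤ complexity (perPoly (Fin n) R) := by
  intro n k R _ _ hPIR hnil hk
  classical
  haveI : IsArtinianRing R := isArtinian_of_finite
  -- a maximal ideal at which `2^k` survives
  obtain ⟨M, hM, hMk⟩ : ∃ (M : Ideal R) (_ : M.IsMaximal),
      algebraMap R (Localization.AtPrime M) ((2 : R) ^ k) ≠ 0 := by
    by_contra h
    push Not at h
    exact hk (eq_zero_of_localization ((2 : R) ^ k) h)
  -- the local quotient `S₀ = R_𝔪` of `R`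
  have hsurj₀ : Function.Surjective (algebraMap R (Localization.AtPrime M)) :=
    IsArtinianRing.localization_surjective M.primeCompl (Localization.AtPrime M)
  haveI hPIR₀ : IsPrincipalIdealRing (Localization.AtPrime M) :=
    IsPrincipalIdealRing.of_surjective (algebraMap R (Localization.AtPrime M)) hsurj₀
  haveI : Finite (Localization.AtPrime M) := Finite.of_surjective _ hsurj₀
  have h2₀ : IsNilpotent (2 : Localization.AtPrime M) := by
    have h := hnil.map (algebraMap R (Localization.AtPrime M))
    rwa [map_ofNat] at h
  have hk₀ : (2 : Localization.AtPrime M) ^ k ≠ 0 := by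
    have h := hMk
    rwa [map_pow, map_ofNat] at h
  -- `S := S₀ ⧸ (2^(k+1))`
  set I : Ideal (Localization.AtPrime M) := Ideal.span {(2 : Localization.AtPrime M) ^ (k + 1)} with hI
  have hkS : (2 : Localization.AtPrime M ⧸ I) ^ k ≠ 0 := by
    intro h0
    apply hk₀
    refine two_pow_eq_zero_of_mem_span h2₀ ?_
    rw [← Ideal.Quotient.eq_zero_iff_mem, map_pow, map_ofNat]
    exact h0
  have h0S : (2 : Localization.AtPrime M ⧸ I) ^ (k + 1) = 0 := by
    have : (Ideal.Quotient.mk I) ((2 : Localization.AtPrime M) ^ (k + 1)) = 0 :=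
      Ideal.Quotient.eq_zero_iff_mem.2 (Ideal.subset_span (Set.mem_singleton _))
    rwa [map_pow, map_ofNat] at this
  haveI : Nontrivial (Localization.AtPrime M ⧸ I) := nontrivial_of_ne _ _ hkS
  haveI : Finite (Localization.AtPrime M ⧸ I) :=
    Finite.of_surjective _ Ideal.Quotient.mk_surjective
  refine ⟨Localization.AtPrime M ⧸ I, inferInstance, Fintype.ofFinite _,
    IsLocalRing.of_surjective' (Ideal.Quotient.mk I) Ideal.Quotient.mk_surjective,
    IsPrincipalIdealRing.of_surjective (Ideal.Quotient.mk I) Ideal.Quotient.mk_surjective,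
    charP_two_pow_succ h0S hkS, ?_⟩
  -- complexity along `R →+* S`
  have h := ArithCircuit.complexity_map_le
    ((Ideal.Quotient.mk I).comp (algebraMap R (Localization.AtPrime M))) (perPoly (Fin n) R)
  rwa [map_perPoly] at h

end Summit.ValiantsHypothesis.ValiantsHypothesis.Theorems.TwoAdicLadderPrecisionLadder
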